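import Literature.MathematicalPhysics.QuantumFieldTheory.Balaban1983to89.B4GaussRep36Proof

/-!
# `Balaban1983to89.B4Ineq115Sect3Route` — T. Bałaban, *Regularity and decay of lattice Green's functions*, Commun.
# Math. Phys. **89** (1983) 571–597 [Balaban1983RegularityDecay], Sect. 3 p. 588 / Prop. 2.3 of [1] (1.15) p. 574:
# the form bounds `γ₀I ≤ Δ^{(k)}(Ω,A) + aL^{−2}P(A) ≤ γ₁I` DERIVED from the Gaussian representation (3.6) and the
# `L²`-bound of the two-scale propagator, over the plain-matrix dictionary of `B4GaussRep36`

statement-level skeleton of published theorems with citation tags; proofs where landed; nothing here is a claim about the Yang–Mills mass gap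

PDF held: `paper:balaban1983-cmp89-regularity-decay` (journal page = PDF page + 570); renders
`run/shared/lean/pub/pub-balaban/b2b-balaban-ref1/pages/1983-cmp89-regularity-decay/1983-cmp89-regularity-decay-p004-x2.png`
((1.13)–(1.15)), `…-p010-x2.png` ((2.28)), `…-p018-x2.png` ((3.5)–(3.8)) read as images.

CITATION HEADER (lean-in-tree rule).  lit-balaban cell (HOME `run/shared/lean/pub/lit-balaban/`), unit `lit-balaban-r01`
(reader/typer of CMP 89 = block B4, paper fold owner; gen 3), SKELETON rows `B4.Prop2.3[I]` (`B4.Prop23Printed`,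
typed-existing), `B4.Eq1.13`/`B4.Eq1.14` (`B4GaussRep36.cOpLam`, `cLam`, `deltaK`), `B4.Eq3.6` (PROVED p240595
`B4GaussRep36Proof.rep36`).  Sibling of `…B4Prop23Sect3Route` ((1.16)/(1.18)/(1.20) by the same route).

THE PRINT.  p. 574 [PDF 4], verbatim: *"There exist positive constants δ₀, c₀, γ₀, γ₁ dependent on d and M only and
such that for arbitrary Λ ⊂ Ω^{(k)} = Ω∩Z^d, Λ being a sum of big blocks and for e sufficiently small, we have γ₀I ≤
Δ^{(k)}(Ω,A) + aL^{−2}P(A) ≤ γ₁I, (1.15)"*; p. 573 (1.13)–(1.14): *"C^{(k)}_Λ(Ω,A) = ((Δ^{(k)}(Ω,A) + aL^{−2}P(A))|_Λ)^{−1}.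
(1.13) … Δ^{(k)}(Ω,A) = a_kI − a_k²Q_k(A)G_k(Ω,A)Q_k^*(A), (1.14)"*; p. 588 [PDF 18]: (3.6) and *"The L²-norms of the
functions q_k(y), q_{k+1}(y) are equal to 1, L^{−d/2} … so the inequalities (1.11), (1.12), and (1.16) ⟦= (1.15), (1.16),
(1.20), in-text references low by four⟧ are simple consequences of Corollary 2.3"*; the `L²` input, p. 580 (2.28):
*"0 < G_k(□,0) ≤ c₀I, c₀^{−1} = min{π², a_k}, hence ‖G_k(□,0)f‖₂ ≤ c₀‖f‖₂. (2.28)"* (the zero-distance case of the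
Corollary 2.3 bound (2.30), asserted for `G_k(Ω,Λ,A)` *"with only slight changes"*, census G-B4-04).

WHAT IS REPRODUCED (kernel, zero `sorry`; inputs as explicit binders — the `L²`/Corollary 2.3 bound for `G_k(Ω,Λ,A)`
ENTERS as hypothesis `hG0`, it is not proved here):
* `form115_upper` — **(1.15), upper bound**, unconditionally in the dictionary: `⟨u,(Δ^{(k)}(Ω,A) + aL^{−2}P(A))u⟩ ≤
  (a_k + aL^{−2})|u|²` for every `u` (from (1.14): `a_k²Q_kG_k(Ω,A)Q_k^* ⪰ 0` by the positivity (1.8) of the form of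
  `G_k(Ω,A)`, and `P(A) ≤ I` for the projection `P`), i.e. `γ₁ = a_k + aL^{−2}`;
* `cLam_form_eq`, `cLam_form_le`, `cLam_posDef` — from the PROVED (3.6) (`h36`): `⟨u, C^{(k)}_Λ u⟩ = ⟨Tᵀu, G_k(Ω,Λ,A)Tᵀu⟩
  − (a_{k+1}/a_k²)L^{−2}⟨u,Pu⟩ + a_k⁻¹|u|²`, hence `0 < C^{(k)}_Λ(Ω,A) ≤ (c′c_k + a_k⁻¹)I` given the `L²` bound `G_k(Ω,Λ,A)
  ≤ c′` (`hG0`, (2.28)-shape) and the Gram bound `TTᵀ ≤ c_k` of the functions (3.8) (`hTT`; `= c_k(1 − θ(2−θ)P_{Λ′})|_Λ`,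
  discharged for the lattice block averaging in `…B4Sect3BlockAveraging.tOp_gram_form_le`);
* `form_inv_lower` — the elementary inversion step `0 < B ≤ βI ⇒ B⁻¹ ≥ β⁻¹I` (discriminant argument, no square roots);
* `cOpLam_form_lower` — **(1.15), lower bound on `Λ`**: `⟨u,(Δ^{(k)}(Ω,A) + aL^{−2}P(A))|_Λ u⟩ ≥ (c′c_k + a_k⁻¹)⁻¹|u|²`,
  `γ₀ = (c′c_k + a_k⁻¹)⁻¹`, and `form115_lower` = the printed full-lattice statement (`Λ = Ω^{(k)}`, where (3.6) represents
  `C^{(k)}(Ω,A)` through `G^η_{k+1}(Ω,A)`), transferred from the subtype `↥univ` to functions on `Ω^{(k)}`.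
No definition is introduced; nothing of the paper beyond these implications is asserted.
-/

namespace Literature.MathematicalPhysics.QuantumFieldTheory.Balaban1983to89.B4Ineq115Sect3Route

open Matrix Finset B4GaussRep36

variable {X Y Z : Type*}

/-! ## §0. Helpers: forms on a sub-lattice `Λ` versus forms on `Ω^{(k)}` (extension by zero) -/

/-- Sums over the subtype `↥Λ` of a function vanishing off `Λ` are sums over the whole index type. [folklore] -/
private theorem sum_coe_eq_sum [Fintype Y] (Λ : Finset Y) (F : Y → ℝ) (hF : ∀ y ∉ Λ, F y = 0) :
    ∑ i : Λ, F i = ∑ y, F y := by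
  rw [Finset.sum_coe_sort Λ F]
  exact Finset.sum_subset (Finset.subset_univ Λ) fun y _ hy => hF y hy

/-- EXTENSION BY ZERO: the form of `M|_Λ` at `u` equals the form of `M` at the extension `ũ` of `u` by zero
(`ũ = u` on `Λ`, `ũ = 0` off `Λ`). [folklore] -/
private theorem dot_submatrix_mulVec [Fintype Y] [DecidableEq Y] (M : Matrix Y Y ℝ) (Λ : Finset Y) (u : Λ → ℝ)
    (ut : Y → ℝ) (hval : ∀ i : Λ, ut i = u i) (hout : ∀ y ∉ Λ, ut y = 0) :
    u ⬝ᵥ (M.submatrix Subtype.val Subtype.val *ᵥ u) = ut ⬝ᵥ (M *ᵥ ut) := by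
  calc u ⬝ᵥ (M.submatrix Subtype.val Subtype.val *ᵥ u)
      = ∑ i : Λ, ut i * ∑ j : Λ, M i j * ut j := by
        simp only [dotProduct, Matrix.mulVec, Matrix.submatrix_apply, hval]
    _ = ∑ i : Λ, ut i * ∑ y', M i y' * ut y' := by
        refine Finset.sum_congr rfl fun i _ => ?_
        exact congrArg (fun r => ut i * r)
          (sum_coe_eq_sum Λ (fun y' => M i y' * ut y') fun y' hy' => by rw [hout y' hy', mul_zero])
    _ = ∑ y, ut y * ∑ y', M y y' * ut y' :=
        sum_coe_eq_sum Λ (fun y => ut y * ∑ y', M y y' * ut y') fun y hy => by rw [hout y hy, zero_mul]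
    _ = ut ⬝ᵥ (M *ᵥ ut) := by simp only [dotProduct, Matrix.mulVec]

/-- … in particular `|u|² = |ũ|²`. [folklore] -/
private theorem dot_self_eq [Fintype Y] [DecidableEq Y] (Λ : Finset Y) (u : Λ → ℝ) (ut : Y → ℝ)
    (hval : ∀ i : Λ, ut i = u i) (hout : ∀ y ∉ Λ, ut y = 0) : u ⬝ᵥ u = ut ⬝ᵥ ut := by
  have h := dot_submatrix_mulVec (1 : Matrix Y Y ℝ) Λ u ut hval hout
  rwa [Matrix.submatrix_one _ Subtype.val_injective, Matrix.one_mulVec, Matrix.one_mulVec] at h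

/-- `|Mᵀu|² = ⟨u, MMᵀu⟩`. [folklore] -/
private theorem dot_mul_transpose_mulVec [Fintype X] {Λ : Type*} [Fintype Λ] (T : Matrix Λ X ℝ) (u : Λ → ℝ) :
    u ⬝ᵥ ((T * Tᵀ) *ᵥ u) = (Tᵀ *ᵥ u) ⬝ᵥ (Tᵀ *ᵥ u) := by
  rw [← Matrix.mulVec_mulVec, Matrix.dotProduct_mulVec, ← Matrix.mulVec_transpose]

/-! ## §1. The inversion step `0 < B ≤ βI ⇒ B⁻¹ ≥ β⁻¹I` -/

/-- INVERSION OF A FORM BOUND (elementary, no square roots): if `A` is positive definite, `B` is its two-sided inverse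
and symmetric, and `⟨u,Bu⟩ ≤ β|u|²` for all `u` (`β > 0`), then `⟨u,Au⟩ ≥ β⁻¹|u|²` — from `0 ≤ ⟨v,Av⟩` at `v = |u|²u −
⟨u,Au⟩Bu`.  This is how *"0 < G ≤ c₀I"*-type statements ((2.28)) pass between an operator and its inverse ((1.13)).
[cite: Balaban1983RegularityDecay, (1.13) p.573, (2.28) p.580] -/
theorem form_inv_lower {n : Type*} [Fintype n] [DecidableEq n] {A B : Matrix n n ℝ} {β : ℝ} (hA : A.PosDef)
    (hAB : A * B = 1) (hBA : B * A = 1) (hBt : Bᵀ = B) (hβ : 0 < β)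
    (hB : ∀ u, u ⬝ᵥ (B *ᵥ u) ≤ β * (u ⬝ᵥ u)) (u : n → ℝ) : β⁻¹ * (u ⬝ᵥ u) ≤ u ⬝ᵥ (A *ᵥ u) := by
  by_cases hu : u = 0
  · subst hu; simp
  have htpos : 0 < u ⬝ᵥ (A *ᵥ u) := by simpa using hA.dotProduct_mulVec_pos hu
  have hspos : 0 < u ⬝ᵥ u := by simpa using (dotProduct_star_self_pos_iff (v := u)).mpr hu
  have h1 : (B *ᵥ u) ⬝ᵥ (A *ᵥ u) = u ⬝ᵥ u := by
    rw [← Matrix.vecMul_transpose, hBt, ← Matrix.dotProduct_mulVec, Matrix.mulVec_mulVec, hBA, Matrix.one_mulVec]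
  have h2 : (B *ᵥ u) ⬝ᵥ u = u ⬝ᵥ (B *ᵥ u) := dotProduct_comm _ _
  set v : n → ℝ := (u ⬝ᵥ u) • u - (u ⬝ᵥ (A *ᵥ u)) • (B *ᵥ u) with hv
  have h0 := hA.posSemidef.dotProduct_mulVec_nonneg v
  rw [star_trivial, hv, Matrix.mulVec_sub, Matrix.mulVec_smul, Matrix.mulVec_smul, Matrix.mulVec_mulVec, hAB,
    Matrix.one_mulVec] at h0
  simp only [sub_dotProduct, dotProduct_sub, smul_dotProduct, dotProduct_smul, smul_eq_mul, h1, h2] at h0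
  have hBu := hB u
  have key : u ⬝ᵥ u ≤ (u ⬝ᵥ (A *ᵥ u)) * β := by
    nlinarith [h0, mul_le_mul_of_nonneg_left hBu (sq_nonneg (u ⬝ᵥ (A *ᵥ u))), mul_pos hspos htpos]
  calc β⁻¹ * (u ⬝ᵥ u) ≤ β⁻¹ * ((u ⬝ᵥ (A *ᵥ u)) * β) := mul_le_mul_of_nonneg_left key (inv_nonneg.mpr hβ.le)
    _ = u ⬝ᵥ (A *ᵥ u) := by field_simp

/-! ## §2. (1.15), upper bound: `Δ^{(k)}(Ω,A) + aL^{−2}P(A) ≤ (a_k + aL^{−2})I` -/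

section Upper

variable [Fintype X] [Fintype Y] [Fintype Z] [DecidableEq X] [DecidableEq Y]

/-- **(1.15), upper bound** *"Δ^{(k)}(Ω,A) + aL^{−2}P(A) ≤ γ₁I"* with the explicit `γ₁ = a_k + aL^{−2}`: by (1.14)
`Δ^{(k)}(Ω,A) = a_kI − a_k²Q_kG_k(Ω,A)Q_k^* ≤ a_kI` (the form of `G_k(Ω,A) = K̂⁻¹` is nonnegative under the positivity
(1.8) of `K̂ = H + a_kQ_kᵀQ_k`) and `⟨u,P(A)u⟩ ≤ |u|²` (`P` a projection, `hPle`; discharged for the block averaging in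
`…B4Sect3BlockAveraging.dotProduct_pOp_mulVec_le`). [cite: Balaban1983RegularityDecay, Prop. 2.3 of [1] (1.15) p.574, (1.14) p.573] -/
theorem form115_upper (H : Matrix X X ℝ) {ak : ℝ} (Qk : Matrix Y X ℝ) {a ℓ w : ℝ} (Q : Matrix Z Y ℝ)
    (hK : (kForm H ak Qk).PosDef) (haℓ : 0 ≤ a * ℓ) (hPle : ∀ v : Y → ℝ, v ⬝ᵥ (pOp w Q *ᵥ v) ≤ v ⬝ᵥ v)
    (u : Y → ℝ) : u ⬝ᵥ ((deltaK H ak Qk + (a * ℓ) • pOp w Q) *ᵥ u) ≤ (ak + a * ℓ) * (u ⬝ᵥ u) := by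
  have hg : 0 ≤ (Qkᵀ *ᵥ u) ⬝ᵥ ((kForm H ak Qk)⁻¹ *ᵥ (Qkᵀ *ᵥ u)) := by
    have h := hK.inv.posSemidef.dotProduct_mulVec_nonneg (Qkᵀ *ᵥ u)
    rwa [star_trivial] at h
  have h1 : u ⬝ᵥ (deltaK H ak Qk *ᵥ u) =
      ak * (u ⬝ᵥ u) - ak ^ 2 * ((Qkᵀ *ᵥ u) ⬝ᵥ ((kForm H ak Qk)⁻¹ *ᵥ (Qkᵀ *ᵥ u))) := by
    rw [deltaK, gk, Matrix.sub_mulVec, dotProduct_sub, Matrix.smul_mulVec, Matrix.one_mulVec, dotProduct_smul,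
      Matrix.smul_mulVec, dotProduct_smul, smul_eq_mul, smul_eq_mul, ← Matrix.mulVec_mulVec,
      ← Matrix.mulVec_mulVec, Matrix.dotProduct_mulVec u Qk, ← Matrix.mulVec_transpose]
  rw [Matrix.add_mulVec, dotProduct_add, h1, Matrix.smul_mulVec, dotProduct_smul, smul_eq_mul]
  nlinarith [mul_nonneg (sq_nonneg ak) hg, mul_le_mul_of_nonneg_left (hPle u) haℓ]

end Upper

/-! ## §3. `0 < C^{(k)}_Λ(Ω,A) ≤ (c′c_k + a_k⁻¹)I` from (3.6), and (1.15), lower bound -/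

section Lower

variable [Fintype X] [Fintype Y] [Fintype Z] [DecidableEq X] [DecidableEq Y] [DecidableEq Z]

/-- The quadratic form of `C^{(k)}_Λ(Ω,A)` through the proved (3.6) (`h36`): `⟨u, C^{(k)}_Λu⟩ = ⟨Tᵀu, G_k(Ω,Λ,A)Tᵀu⟩ −
(a_{k+1}/a_k²)L^{−2}⟨u, P|_Λu⟩ + a_k⁻¹|u|²`. [cite: Balaban1983RegularityDecay, (3.6) p.588, (1.13) p.573] -/
theorem cLam_form_eq {H : Matrix X X ℝ} {ak : ℝ} {Qk : Matrix Y X ℝ} {a ℓ w : ℝ} {Q : Matrix Z Y ℝ}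
    {Λ : Finset Y} {Λ' : Finset Z} (h36 : cLam H ak Qk a ℓ w Q Λ = rep36Rhs H ak Qk a ℓ w Q Λ Λ') (u : Λ → ℝ) :
    u ⬝ᵥ (cLam H ak Qk a ℓ w Q Λ *ᵥ u) =
      ((tOp ak Qk a ℓ w Q Λ Λ')ᵀ *ᵥ u) ⬝ᵥ (gLam H ak Qk a ℓ w Q Λ Λ' *ᵥ ((tOp ak Qk a ℓ w Q Λ Λ')ᵀ *ᵥ u))
        - aNext a ak ℓ * ℓ / ak ^ 2 * (u ⬝ᵥ ((pOp w Q).submatrix Subtype.val Subtype.val *ᵥ u))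
        + 1 / ak * (u ⬝ᵥ u) := by
  rw [h36, rep36Rhs, Matrix.add_mulVec, Matrix.sub_mulVec, dotProduct_add, dotProduct_sub, Matrix.smul_mulVec,
    Matrix.smul_mulVec, dotProduct_smul, dotProduct_smul, Matrix.one_mulVec, smul_eq_mul, smul_eq_mul,
    ← Matrix.mulVec_mulVec, ← Matrix.mulVec_mulVec, Matrix.dotProduct_mulVec u (tOp ak Qk a ℓ w Q Λ Λ'),
    ← Matrix.mulVec_transpose]
  rw [show aNext a ak ℓ / ak ^ 2 * ℓ = aNext a ak ℓ * ℓ / ak ^ 2 from by ring]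

/-- **`C^{(k)}_Λ(Ω,A) ≤ (c′c_k + a_k⁻¹)I`**: from (3.6), the `L²` bound `⟨g, G_k(Ω,Λ,A)g⟩ ≤ c′|g|²` ((2.28)-shape,
`hG0`, INPUT), the Gram bound `⟨u,TTᵀu⟩ ≤ c_k|u|²` of the functions (3.8) (`hTT`, *"The L²-norms of the functions … are
equal to 1, L^{−d/2}"*) and `⟨u,P|_Λu⟩ ≥ 0`. [cite: Balaban1983RegularityDecay, (3.6) p.588, (2.28) p.580] -/
theorem cLam_form_le {H : Matrix X X ℝ} {ak : ℝ} {Qk : Matrix Y X ℝ} {a ℓ w : ℝ} {Q : Matrix Z Y ℝ}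
    {Λ : Finset Y} {Λ' : Finset Z} {c' ck : ℝ} (h36 : cLam H ak Qk a ℓ w Q Λ = rep36Rhs H ak Qk a ℓ w Q Λ Λ')
    (hG0 : ∀ g : X → ℝ, g ⬝ᵥ (gLam H ak Qk a ℓ w Q Λ Λ' *ᵥ g) ≤ c' * (g ⬝ᵥ g)) (hc' : 0 ≤ c')
    (hTT : ∀ u : Λ → ℝ, u ⬝ᵥ ((tOp ak Qk a ℓ w Q Λ Λ' * (tOp ak Qk a ℓ w Q Λ Λ')ᵀ) *ᵥ u) ≤ ck * (u ⬝ᵥ u))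
    (hPΛnn : ∀ u : Λ → ℝ, 0 ≤ u ⬝ᵥ ((pOp w Q).submatrix Subtype.val Subtype.val *ᵥ u))
    (hθ : 0 ≤ aNext a ak ℓ * ℓ) (u : Λ → ℝ) :
    u ⬝ᵥ (cLam H ak Qk a ℓ w Q Λ *ᵥ u) ≤ (c' * ck + 1 / ak) * (u ⬝ᵥ u) := by
  rw [cLam_form_eq h36]
  have h1 := hG0 ((tOp ak Qk a ℓ w Q Λ Λ')ᵀ *ᵥ u)
  rw [← dot_mul_transpose_mulVec] at h1
  have h2 := mul_le_mul_of_nonneg_left (hTT u) hc'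
  have h3 : 0 ≤ aNext a ak ℓ * ℓ / ak ^ 2 * (u ⬝ᵥ ((pOp w Q).submatrix Subtype.val Subtype.val *ᵥ u)) :=
    mul_nonneg (div_nonneg hθ (sq_nonneg _)) (hPΛnn u)
  nlinarith [h1, h2, h3]

/-- The ratio estimate behind positivity: `a_k⁻¹ − (a_{k+1}/a_k²)L^{−2} = (aL^{−2} + a_k)⁻¹ > 0` (from *"a_{k+1} =
aa_k/(aL^{−2} + a_k)"*, p. 587). [cite: Balaban1983RegularityDecay, (3.4) p.587] -/
theorem inv_ak_sub_coef (a ak ℓ : ℝ) (hak : ak ≠ 0) (h : a * ℓ + ak ≠ 0) :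
    1 / ak - aNext a ak ℓ * ℓ / ak ^ 2 = 1 / (a * ℓ + ak) := by
  rw [aNext]
  field_simp
  ring

/-- **`C^{(k)}_Λ(Ω,A) > 0`**: from (3.6) — `⟨Tᵀu, G_k(Ω,Λ,A)Tᵀu⟩ ≥ 0` (positivity (1.8) of the two-scale form (3.5)),
`⟨u,P|_Λu⟩ ≤ |u|²` (`P` a projection) and `a_k⁻¹ − (a_{k+1}/a_k²)L^{−2} = (aL^{−2} + a_k)⁻¹ > 0` — the covariance of the
Gaussian (3.1) is positive definite. [cite: Balaban1983RegularityDecay, (3.6) p.588, (1.13) p.573] -/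
theorem cLam_posDef {H : Matrix X X ℝ} {ak : ℝ} {Qk : Matrix Y X ℝ} {a ℓ w : ℝ} {Q : Matrix Z Y ℝ}
    {Λ : Finset Y} {Λ' : Finset Z} (h36 : cLam H ak Qk a ℓ w Q Λ = rep36Rhs H ak Qk a ℓ w Q Λ Λ')
    (hKΛ : (kLam H ak Qk a ℓ w Q Λ Λ').PosDef)
    (hPΛle : ∀ u : Λ → ℝ, u ⬝ᵥ ((pOp w Q).submatrix Subtype.val Subtype.val *ᵥ u) ≤ u ⬝ᵥ u)
    (hak : 0 < ak) (ha : 0 ≤ a) (hℓ : 0 ≤ ℓ) : (cLam H ak Qk a ℓ w Q Λ).PosDef := by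
  have hden : 0 < a * ℓ + ak := by positivity
  have hθ : 0 ≤ aNext a ak ℓ * ℓ := by rw [aNext]; positivity
  refine Matrix.PosDef.of_dotProduct_mulVec_pos ?_ fun u hu => ?_
  · -- symmetry of the right-hand side of (3.6)
    have hKt : (kLam H ak Qk a ℓ w Q Λ Λ')ᵀ = kLam H ak Qk a ℓ w Q Λ Λ' := by
      have h := hKΛ.isHermitian
      rwa [Matrix.IsHermitian, Matrix.conjTranspose_eq_transpose_of_trivial] at h
    have hGt : (gLam H ak Qk a ℓ w Q Λ Λ')ᵀ = gLam H ak Qk a ℓ w Q Λ Λ' := by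
      rw [gLam, Matrix.transpose_nonsing_inv, hKt]
    have hPt : (pOp w Q)ᵀ = pOp w Q := by
      rw [pOp, Matrix.transpose_smul, Matrix.transpose_mul, Matrix.transpose_transpose]
    rw [Matrix.IsHermitian, Matrix.conjTranspose_eq_transpose_of_trivial, h36, rep36Rhs, Matrix.transpose_add,
      Matrix.transpose_sub, Matrix.transpose_smul, Matrix.transpose_smul, Matrix.transpose_one,
      Matrix.transpose_submatrix, hPt, Matrix.transpose_mul, Matrix.transpose_mul, Matrix.transpose_transpose, hGt,
      Matrix.mul_assoc]
  · have hspos : 0 < u ⬝ᵥ u := by simpa using (dotProduct_star_self_pos_iff (v := u)).mpr hu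
    have hG : 0 ≤ ((tOp ak Qk a ℓ w Q Λ Λ')ᵀ *ᵥ u) ⬝ᵥ
        (gLam H ak Qk a ℓ w Q Λ Λ' *ᵥ ((tOp ak Qk a ℓ w Q Λ Λ')ᵀ *ᵥ u)) := by
      have h := hKΛ.inv.posSemidef.dotProduct_mulVec_nonneg ((tOp ak Qk a ℓ w Q Λ Λ')ᵀ *ᵥ u)
      rwa [star_trivial] at h
    have hgap : 0 < 1 / ak - aNext a ak ℓ * ℓ / ak ^ 2 := by
      rw [inv_ak_sub_coef a ak ℓ hak.ne' hden.ne']; positivity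
    rw [star_trivial, cLam_form_eq h36]
    have hP := mul_le_mul_of_nonneg_left (hPΛle u) (div_nonneg hθ (sq_nonneg ak))
    nlinarith [mul_pos hgap hspos, hG, hP]

/-- **(1.15), lower bound on `Λ`** *"γ₀I ≤ Δ^{(k)}(Ω,A) + aL^{−2}P(A)"* restricted to `Λ` (`(Δ^{(k)} + aL^{−2}P)|_Λ =
(C^{(k)}_Λ)^{−1}`, (1.13)), with the explicit `γ₀ = (c′c_k + a_k⁻¹)⁻¹`: from `0 < C^{(k)}_Λ(Ω,A) ≤ (c′c_k + a_k⁻¹)I`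
(`cLam_posDef`, `cLam_form_le`) by the inversion step `form_inv_lower`.  Inputs: the proved (3.6) (`h36`), positivity
(1.8) of the form (3.5), the `L²` bound of `G_k(Ω,Λ,A)` (`hG0`, (2.28)/(2.30)-shape — the INPUT asserted in print for
the two-scale propagator), the Gram bound of the (3.8) functions (`hTT`) and the projection bounds `0 ≤ ⟨u,P|_Λu⟩ ≤
|u|²`. [cite: Balaban1983RegularityDecay, Prop. 2.3 of [1] (1.15) p.574, (3.6) p.588] -/
theorem cOpLam_form_lower {H : Matrix X X ℝ} {ak : ℝ} {Qk : Matrix Y X ℝ} {a ℓ w : ℝ} {Q : Matrix Z Y ℝ}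
    {Λ : Finset Y} {Λ' : Finset Z} {c' ck : ℝ} (h36 : cLam H ak Qk a ℓ w Q Λ = rep36Rhs H ak Qk a ℓ w Q Λ Λ')
    (hKΛ : (kLam H ak Qk a ℓ w Q Λ Λ').PosDef)
    (hG0 : ∀ g : X → ℝ, g ⬝ᵥ (gLam H ak Qk a ℓ w Q Λ Λ' *ᵥ g) ≤ c' * (g ⬝ᵥ g)) (hc' : 0 ≤ c')
    (hTT : ∀ u : Λ → ℝ, u ⬝ᵥ ((tOp ak Qk a ℓ w Q Λ Λ' * (tOp ak Qk a ℓ w Q Λ Λ')ᵀ) *ᵥ u) ≤ ck * (u ⬝ᵥ u))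
    (hck : 0 ≤ ck) (hPΛnn : ∀ u : Λ → ℝ, 0 ≤ u ⬝ᵥ ((pOp w Q).submatrix Subtype.val Subtype.val *ᵥ u))
    (hPΛle : ∀ u : Λ → ℝ, u ⬝ᵥ ((pOp w Q).submatrix Subtype.val Subtype.val *ᵥ u) ≤ u ⬝ᵥ u) (hak : 0 < ak)
    (ha : 0 ≤ a) (hℓ : 0 ≤ ℓ) (u : Λ → ℝ) :
    (c' * ck + 1 / ak)⁻¹ * (u ⬝ᵥ u) ≤ u ⬝ᵥ (cOpLam H ak Qk a ℓ w Q Λ *ᵥ u) := by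
  have hθ : 0 ≤ aNext a ak ℓ * ℓ := by rw [aNext]; positivity
  have hβ : 0 < c' * ck + 1 / ak := by positivity
  rcases isEmpty_or_nonempty Λ with hΛ | hΛ
  · have hu : u = 0 := Subsingleton.elim _ _
    subst hu; simp
  have hBpd : (cLam H ak Qk a ℓ w Q Λ).PosDef := cLam_posDef h36 hKΛ hPΛle hak ha hℓ
  have hdet : IsUnit (cOpLam H ak Qk a ℓ w Q Λ).det := by
    by_contra hnd
    have h0 : cLam H ak Qk a ℓ w Q Λ = 0 := by rw [cLam, Matrix.nonsing_inv_apply_not_isUnit _ hnd]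
    obtain ⟨y⟩ := hΛ
    have hne : (Pi.single y (1 : ℝ) : Λ → ℝ) ≠ 0 := by
      intro h
      have := congrFun h y
      simp at this
    have hpos := hBpd.dotProduct_mulVec_pos hne
    rw [h0, Matrix.zero_mulVec, dotProduct_zero] at hpos
    exact lt_irrefl _ hpos
  have hAB : cOpLam H ak Qk a ℓ w Q Λ * cLam H ak Qk a ℓ w Q Λ = 1 := Matrix.mul_nonsing_inv _ hdet
  have hBA : cLam H ak Qk a ℓ w Q Λ * cOpLam H ak Qk a ℓ w Q Λ = 1 := Matrix.nonsing_inv_mul _ hdet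
  have hA : (cOpLam H ak Qk a ℓ w Q Λ).PosDef := by
    rw [← Matrix.nonsing_inv_nonsing_inv _ hdet]
    exact hBpd.inv
  have hBt : (cLam H ak Qk a ℓ w Q Λ)ᵀ = cLam H ak Qk a ℓ w Q Λ := by
    have h := hBpd.isHermitian
    rwa [Matrix.IsHermitian, Matrix.conjTranspose_eq_transpose_of_trivial] at h
  exact form_inv_lower hA hAB hBA hBt hβ (cLam_form_le h36 hG0 hc' hTT hPΛnn hθ) u

/-- **(1.15), lower bound, AS PRINTED on `L²(Ω^{(k)})`** *"γ₀I ≤ Δ^{(k)}(Ω,A) + aL^{−2}P(A)"* (`γ₀ = (c′c_k + a_k⁻¹)⁻¹`): the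
case `Λ = Ω^{(k)}` of `cOpLam_form_lower` — there (3.6) represents `C^{(k)}(Ω,A) = C^{(k)}_{Ω^{(k)}}(Ω,A)` through
`G^η_{k+1}(Ω,A)` and the `L²` input is `⟨g, G^η_{k+1}(Ω,A)g⟩ ≤ c′|g|²` — transferred from the subtype `↥Ω^{(k)}` to
functions on `Ω^{(k)}`; the projection bounds `0 ≤ ⟨v,P(A)v⟩ ≤ |v|²` enter as `hPnn`/`hPle`.
[cite: Balaban1983RegularityDecay, Prop. 2.3 of [1] (1.15) p.574, (3.6) p.588] -/
theorem form115_lower {H : Matrix X X ℝ} {ak : ℝ} {Qk : Matrix Y X ℝ} {a ℓ w : ℝ} {Q : Matrix Z Y ℝ} {c' ck : ℝ}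
    (h36U : cLam H ak Qk a ℓ w Q Finset.univ = rep36Rhs H ak Qk a ℓ w Q Finset.univ Finset.univ)
    (hKU : (kLam H ak Qk a ℓ w Q Finset.univ Finset.univ).PosDef)
    (hG0 : ∀ g : X → ℝ, g ⬝ᵥ (gNext H ak Qk a ℓ w Q *ᵥ g) ≤ c' * (g ⬝ᵥ g)) (hc' : 0 ≤ c')
    (hTT : ∀ u : ↥(Finset.univ : Finset Y) → ℝ,
      u ⬝ᵥ ((tOp ak Qk a ℓ w Q Finset.univ Finset.univ * (tOp ak Qk a ℓ w Q Finset.univ Finset.univ)ᵀ) *ᵥ u)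
        ≤ ck * (u ⬝ᵥ u))
    (hck : 0 ≤ ck) (hPnn : ∀ v : Y → ℝ, 0 ≤ v ⬝ᵥ (pOp w Q *ᵥ v))
    (hPle : ∀ v : Y → ℝ, v ⬝ᵥ (pOp w Q *ᵥ v) ≤ v ⬝ᵥ v) (hak : 0 < ak) (ha : 0 ≤ a) (hℓ : 0 ≤ ℓ) (v : Y → ℝ) :
    (c' * ck + 1 / ak)⁻¹ * (v ⬝ᵥ v) ≤ v ⬝ᵥ ((deltaK H ak Qk + (a * ℓ) • pOp w Q) *ᵥ v) := by
  -- the extension-by-zero dictionary between `↥univ → ℝ` and `Y → ℝ`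
  have tr : ∀ (M : Matrix Y Y ℝ) (u : ↥(Finset.univ : Finset Y) → ℝ),
      u ⬝ᵥ (M.submatrix Subtype.val Subtype.val *ᵥ u) =
        (fun y => u ⟨y, Finset.mem_univ y⟩) ⬝ᵥ (M *ᵥ fun y => u ⟨y, Finset.mem_univ y⟩) :=
    fun M u => dot_submatrix_mulVec M _ u _ (fun i => rfl) (fun y hy => absurd (Finset.mem_univ y) hy)
  have trs : ∀ u : ↥(Finset.univ : Finset Y) → ℝ,
      u ⬝ᵥ u = (fun y => u ⟨y, Finset.mem_univ y⟩) ⬝ᵥ (fun y => u ⟨y, Finset.mem_univ y⟩) :=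
    fun u => dot_self_eq _ u _ (fun i => rfl) (fun y hy => absurd (Finset.mem_univ y) hy)
  have hPΛnn : ∀ u : ↥(Finset.univ : Finset Y) → ℝ,
      0 ≤ u ⬝ᵥ ((pOp w Q).submatrix Subtype.val Subtype.val *ᵥ u) := fun u => by
    rw [tr]; exact hPnn _
  have hPΛle : ∀ u : ↥(Finset.univ : Finset Y) → ℝ,
      u ⬝ᵥ ((pOp w Q).submatrix Subtype.val Subtype.val *ᵥ u) ≤ u ⬝ᵥ u := fun u => by
    rw [tr, trs]; exact hPle _
  have h := cOpLam_form_lower h36U hKU hG0 hc' hTT hck hPΛnn hPΛle hak ha hℓ (fun i => v i.1)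
  rw [trs, cOpLam, tr] at h
  exact h

end Lower

end Literature.MathematicalPhysics.QuantumFieldTheory.Balaban1983to89.B4Ineq115Sect3Route
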